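import Summits.HodgeConjecture.CorCM.MumfordTateRankProductRigidFactors
import Summits.HodgeConjecture.CorCM.MumfordTateRankSevenSimpleConverse
import Summits.HodgeConjecture.CorCM.MumfordTateRankSimpleSurfacesSharp
import Summits.HodgeConjecture.CorCM.MumfordTateRankEllipticProducts
import Literature.AlgebraicGeometry.HodgeTheory.SimpleSurfaceTimesCMCurveStablyNondegenerate
import Literature.AlgebraicGeometry.HodgeTheory.NoTypeIVTimesCMStablyNondegenerate
import HarnessLib

/-!
# The Mumford–Tate rank of a CURVE × a SIMPLE SURFACE: the table `4, 5, 6, 7, 8, 10, 12, 14`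

COR-CM (cell `pub-hodgecm2`, seat `b27` gen 47, count-neutral Mumford–Tate-rank ladder; theorems only, no definition, no named fact;
UNCONDITIONAL — nothing here uses or asserts HC_CM).  For `X ∼ E × S` with `E` an elliptic curve and `S` a SIMPLE abelian surface,
`t = dim MT(H¹X)` is determined by the CM type of `E` and the endomorphism type of `S` (`dim_ℚ End⁰S ∈ {1, 2, 4}`; `4` commutative =
quartic CM field, `4` non-commutative = indefinite quaternions, `CorCM/MumfordTateRankSimpleSurfacesSharp`):

| `E` \\ `S`   | CM (`t(S) = 3`) | QM (`4`) | RM (`7`) | `End⁰S = ℚ` (`11`) |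
|--------------|-----------------|----------|----------|--------------------|
| CM (`2`)     | `≤ 4`           | `5`      | `8`      | `12`               |
| non-CM (`4`) | `6`             | `7`      | **`10`** | **`14`**           |

Row «CM curve»: `t(X) = t(S) + 1` for `S` without factor of type IV (Moonen–Zarhin Thm. (3.2)(2), `CorCM/MumfordTateRankSemisimpleTimesCM`).
Cell `6`: the same theorem with the roles exchanged.  Cell `7`: `CorCM/MumfordTateRankSevenSplitConverse`.  The two NEW cells `10` and
`14` are `Hg(E × S) = Hg(E) × Hg(S)` for a non-CM curve and a surface with real multiplication / with `End⁰S = ℚ`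
(`CorCM/MumfordTateRankProductRigidFactors`: both factors are `Θ`-rigid, `Lie Hg(H¹E) ≅ 𝔰𝔩₂` is simple, and `Lie Hg(H¹S)` is
`ℚ`-simple of dimension `6 ≠ 3`, resp. semisimple of dimension `10 = 3 + 7`).  The CM × CM cell (`= 4`, by the `t ≤ 3` classification)
is completed in `CorCM/MumfordTateRankThreefoldsSharp`.

## References
* [MoonenZarhin1999LowDim] B. Moonen, Yu. G. Zarhin, *Hodge classes on abelian varieties of low dimension*, Math. Ann. 315 (1999),
  §2 (2.2), §3 (3.1)–(3.2) [corpus: paper:arxiv-math_9901113 pp. 5–6]. [cite: MoonenZarhin1999LowDim, §3 (3.1) and Thm. (3.2)(2)]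
* [Hazama1983] F. Hazama, Tôhoku Math. J. 35 (1983), Lemma (3.1). [cite: Hazama1983, Lemma (3.1)]
* [Imai1976] H. Imai, *On the Hodge groups of some abelian varieties*, Kodai Math. Sem. Rep. 27 (1976) 367–372 (products with
  elliptic curves). [cite: MoonenZarhin1999LowDim, §3 (3.4)]
-/

noncomputable section

open scoped TensorProduct
open CategoryTheory CategoryTheory.Limits Module

namespace Summit.HodgeConjecture.CorCM

open Literature.AlgebraicGeometry.Motives
open Literature.AlgebraicGeometry.Motives.AbelianVariety
open Literature.AlgebraicGeometry.Motives.HodgeStructure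
open Literature.AlgebraicGeometry.HodgeTheory
open Literature.AlgebraicGeometry.Milne1999 (IsOfCMType)

variable [HodgeTensorFacts.{0, 0}] {X : AbelianVariety ℂ} {n : ℕ}

/-! ## §1 Non-CM curve × RM surface: `t = 10` -/

/-- **`t(E × S) = 10` for a NON-CM elliptic curve `E` and a simple abelian surface `S` with REAL MULTIPLICATION** (`dim_ℚ End⁰S = 2`):
`Hg(E × S) = SL₂ × R_{K/ℚ} SL₂`, `t + 1 = 4 + 7`.  Both factors are `Θ`-rigid, `Lie Hg(H¹E)` is simple of dimension `3`, `Lie Hg(H¹S)`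
is `ℚ`-simple of dimension `6`. [cite: MoonenZarhin1999LowDim, §3 (3.1)] [cite: Hazama1983, Lemma (3.1)] -/
theorem mtRank_hodge_one_eq_ten_of_isIsogenous_curve_prod_rmSurface (hX : IsSmoothProjective n X.X) {E S : AbelianVariety ℂ}
    (hE1 : E.dim = 1) (hcm : ¬ IsOfCMType E) (hSs : S.IsSimple) (hS2 : S.dim = 2) (hSE : Module.finrank ℚ S.endAlgebra = 2)
    (hXP : IsIsogenous X (E.prod S)) :
    haveI := BettiUniverse.finite hX 1
    (BettiUniverse.hodge exists_isReal_hodgeModel_holds hX 1).mtRank = 10 := by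
  have hE : IsSmoothProjective E.dim E.X := AbelianVariety.isSmoothProjective_holds
  have hS : IsSmoothProjective S.dim S.X := AbelianVariety.isSmoothProjective_holds
  haveI := BettiUniverse.finite hX 1
  haveI := BettiUniverse.finite hE 1
  haveI := BettiUniverse.finite hS 1
  obtain ⟨h4, -, hA4, -⟩ := curve_facts_of_not_isOfCMType hE1 hcm
  obtain ⟨h7, -, -, -, -⟩ := mtRank_hodge_one_eq_seven_of_isIsogenous_powSucc_rmSurface hS hSs hS2 hSE (m := 0) (IsIsogenous.refl S)
  have hfE := mtRank_hodge_one_eq_finrank_hodgeLie_add_one hE (by omega)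
  have hfS := mtRank_hodge_one_eq_finrank_hodgeLie_add_one hS (by omega)
  have h := mtRank_hodge_one_add_one_eq_add_of_isIsogenous_prod_of_rigid hX hE hS (by omega) (by omega)
    (hodgeLie_rigid_of_not_isOfCMType_of_mtRank_le_four hE (by omega) hcm h4.le)
    (hodgeLie_rigid_of_isSimple_surface_of_finrank_endAlgebra_eq_two hS hSs hS2 hSE)
    (isSimple_hodgeLie_hodge_one_of_hasNoTypeIVFactor_of_mtRank_eq_four hE (by omega) hA4 h4)
    (Or.inl ⟨isSimple_hodgeLie_of_isIsogenous_powSucc_rmSurface hS hSs hS2 hSE (m := 0) (IsIsogenous.refl S), by omega⟩) hXP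
  omega

/-! ## §2 Non-CM curve × surface with `End⁰ = ℚ`: `t = 14` -/

/-- **`t(E × S) = 14` for a NON-CM elliptic curve `E` and an abelian surface `S` with `End⁰S = ℚ`**: `Hg(E × S) = SL₂ × Sp₄`,
`t + 1 = 4 + 11`.  Both factors are `Θ`-rigid, `Lie Hg(H¹E)` is simple of dimension `3`, `Lie Hg(H¹S) = 𝔰𝔭₄` is semisimple of
dimension `10 = 3 + 7` and a semisimple Lie algebra has no ideal of dimension `7`. [cite: MoonenZarhin1999LowDim, §3 (3.1)]
[cite: Hazama1983, Lemma (3.1)] -/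
theorem mtRank_hodge_one_eq_fourteen_of_isIsogenous_curve_prod_surface_endRankOne (hX : IsSmoothProjective n X.X)
    {E S : AbelianVariety ℂ} (hE1 : E.dim = 1) (hcm : ¬ IsOfCMType E) (hS2 : S.dim = 2) (hSE : Module.finrank ℚ S.endAlgebra = 1)
    (hXP : IsIsogenous X (E.prod S)) :
    haveI := BettiUniverse.finite hX 1
    (BettiUniverse.hodge exists_isReal_hodgeModel_holds hX 1).mtRank = 14 := by
  have hE : IsSmoothProjective E.dim E.X := AbelianVariety.isSmoothProjective_holds
  have hS : IsSmoothProjective S.dim S.X := AbelianVariety.isSmoothProjective_holds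
  haveI := BettiUniverse.finite hX 1
  haveI := BettiUniverse.finite hE 1
  haveI := BettiUniverse.finite hS 1
  obtain ⟨h4, -, hA4, -⟩ := curve_facts_of_not_isOfCMType hE1 hcm
  obtain ⟨h11, h10⟩ := mtRank_hodge_one_eq_eleven_of_surface_of_finrank_endAlgebra_eq_one hS hS2 hSE
  have hfE := mtRank_hodge_one_eq_finrank_hodgeLie_add_one hE (by omega)
  have hS4 : HasNoTypeIVFactor S := hasNoTypeIVFactor_of_finrank_endAlgebra_eq_one hSE
  have h := mtRank_hodge_one_add_one_eq_add_of_isIsogenous_prod_of_rigid hX hE hS (by omega) (by omega)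
    (hodgeLie_rigid_of_not_isOfCMType_of_mtRank_le_four hE (by omega) hcm h4.le)
    (hodgeLie_rigid_of_surface_of_finrank_endAlgebra_eq_one hS hS2 hSE)
    (isSimple_hodgeLie_hodge_one_of_hasNoTypeIVFactor_of_mtRank_eq_four hE (by omega) hA4 h4)
    (Or.inr ⟨fun 𝔏 h𝔏 => (isSemisimple_of_eq_hodgeLie_hodge_one_of_hasNoTypeIVFactor hS hS4 𝔏 h𝔏).1, by omega⟩) hXP
  omega

/-! ## §3 The remaining cells with a non-CM surface -/

/-- **`t(E × S) = 6` for a NON-CM elliptic curve and a simple CM surface** (`t + 1 = 4 + 3`; `E` has no factor of type IV, `S` is of CM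
type). [cite: MoonenZarhin1999LowDim, §3 Thm. (3.2)(2)] -/
theorem mtRank_hodge_one_eq_six_of_isIsogenous_curve_prod_cmSurface (hX : IsSmoothProjective n X.X) {E S : AbelianVariety ℂ}
    (hE1 : E.dim = 1) (hcm : ¬ IsOfCMType E) (hSs : S.IsSimple) (hS2 : S.dim = 2) (hScm : IsOfCMType S)
    (hXP : IsIsogenous X (E.prod S)) :
    haveI := BettiUniverse.finite hX 1
    (BettiUniverse.hodge exists_isReal_hodgeModel_holds hX 1).mtRank = 6 := by
  have hE : IsSmoothProjective E.dim E.X := AbelianVariety.isSmoothProjective_holds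
  have hS : IsSmoothProjective S.dim S.X := AbelianVariety.isSmoothProjective_holds
  haveI := BettiUniverse.finite hX 1
  haveI := BettiUniverse.finite hE 1
  haveI := BettiUniverse.finite hS 1
  obtain ⟨h4, -, hA4, -⟩ := curve_facts_of_not_isOfCMType hE1 hcm
  have h3 := (isOfCMType_iff_mtRank_hodge_one_eq_three_of_isSimple_surface hS hSs hS2).1 hScm
  have h := mtRank_hodge_one_add_one_eq_add_of_isIsogenous_prod hX hE hS (by omega) (by omega) hA4 hScm hXP
  omega

/-- **`t(E × S) = t(S) + 1` for a CM elliptic curve `E` and ANY abelian variety `S` without factor of type IV** (`t(E) = 2`).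
[cite: MoonenZarhin1999LowDim, §3 Thm. (3.2)(2)] -/
theorem mtRank_hodge_one_eq_add_one_of_isIsogenous_cmCurve_prod (hX : IsSmoothProjective n X.X) {E S : AbelianVariety ℂ} {k : ℕ}
    (hS : IsSmoothProjective k S.X) (hE1 : E.dim = 1) (hcm : IsOfCMType E) (hS0 : 0 < S.dim) (hS4 : HasNoTypeIVFactor S)
    (hXP : IsIsogenous X (E.prod S)) :
    haveI := BettiUniverse.finite hX 1
    haveI := BettiUniverse.finite hS 1
    (BettiUniverse.hodge exists_isReal_hodgeModel_holds hX 1).mtRank = (BettiUniverse.hodge exists_isReal_hodgeModel_holds hS 1).mtRank + 1 := by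
  have hE : IsSmoothProjective E.dim E.X := AbelianVariety.isSmoothProjective_holds
  haveI := BettiUniverse.finite hX 1
  haveI := BettiUniverse.finite hE 1
  haveI := BettiUniverse.finite hS 1
  have h2 := mtRank_hodge_one_eq_two_of_cm_curve hE1 hcm
  have h := mtRank_hodge_one_add_one_eq_add_of_isIsogenous_prod hX hS hE hS0 (by omega) hS4 hcm
    (hXP.trans (isIsogenous_prod_comm E S))
  omega

/-- **CM curve × simple NON-CM surface: `t(E × S) = t(S) + 1 ∈ {5, 8, 12}`**, namely `5` for a QM surface (`dim_ℚ End⁰S = 4`), `8` for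
real multiplication (`dim_ℚ End⁰S = 2`), `12` for `End⁰S = ℚ`. [cite: MoonenZarhin1999LowDim, §2 (2.2) and §3 Thm. (3.2)(2)] -/
theorem mtRank_hodge_one_of_isIsogenous_cmCurve_prod_isSimple_surface (hX : IsSmoothProjective n X.X) {E S : AbelianVariety ℂ}
    (hE1 : E.dim = 1) (hcm : IsOfCMType E) (hSs : S.IsSimple) (hS2 : S.dim = 2) (hScm : ¬ IsOfCMType S)
    (hXP : IsIsogenous X (E.prod S)) :
    haveI := BettiUniverse.finite hX 1
    (Module.finrank ℚ S.endAlgebra = 4 ∧ (BettiUniverse.hodge exists_isReal_hodgeModel_holds hX 1).mtRank = 5) ∨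
      (Module.finrank ℚ S.endAlgebra = 2 ∧ (BettiUniverse.hodge exists_isReal_hodgeModel_holds hX 1).mtRank = 8) ∨
      (Module.finrank ℚ S.endAlgebra = 1 ∧ (BettiUniverse.hodge exists_isReal_hodgeModel_holds hX 1).mtRank = 12) := by
  have hS : IsSmoothProjective S.dim S.X := AbelianVariety.isSmoothProjective_holds
  haveI := BettiUniverse.finite hX 1
  haveI := BettiUniverse.finite hS 1
  have hS4 : HasNoTypeIVFactor S := hasNoTypeIVFactor_of_isSimple_surface_of_not_isOfCMType hSs hS2 hScm
  have h := mtRank_hodge_one_eq_add_one_of_isIsogenous_cmCurve_prod hX hS hE1 hcm (by omega) hS4 hXP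
  rcases mtRank_hodge_one_of_isSimple_surface_sharp hS hSs hS2 with ⟨h1, h11⟩ | ⟨h2, h7⟩ | ⟨-, -, hcm', -⟩ | ⟨h4, -, h4'⟩
  · exact Or.inr (Or.inr ⟨h1, by omega⟩)
  · exact Or.inr (Or.inl ⟨h2, by omega⟩)
  · exact absurd hcm' hScm
  · exact Or.inl ⟨h4, by omega⟩

/-- **`t(E × S) = 7` for a NON-CM elliptic curve and a simple QM surface** (`dim_ℚ End⁰S = 4`, non-commutative): `Hg = SL₂ × SL₁(D)`
(`CorCM/MumfordTateRankSevenSplitConverse`; `E ≁ S` by dimension). [cite: MoonenZarhin1999LowDim, §2 (2.2) and §3 (3.1)] -/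
theorem mtRank_hodge_one_eq_seven_of_isIsogenous_curve_prod_qmSurface (hX : IsSmoothProjective n X.X) {E S : AbelianVariety ℂ}
    (hE1 : E.dim = 1) (hcm : ¬ IsOfCMType E) (hSs : S.IsSimple) (hS2 : S.dim = 2) (hSE : Module.finrank ℚ S.endAlgebra = 4)
    (hScm : ¬ IsOfCMType S) (hXP : IsIsogenous X (E.prod S)) :
    haveI := BettiUniverse.finite hX 1
    (BettiUniverse.hodge exists_isReal_hodgeModel_holds hX 1).mtRank = 7 := by
  classical
  have hS : IsSmoothProjective S.dim S.X := AbelianVariety.isSmoothProjective_holds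
  haveI := BettiUniverse.finite hX 1
  haveI := BettiUniverse.finite hS 1
  obtain ⟨-, hfE, -, hzE⟩ := curve_facts_of_not_isOfCMType hE1 hcm
  -- the QM surface: `dim End⁰S = 4 = (dim S)²`, centre `ℚ`
  have hS0 : 0 < S.dim := by omega
  have h4S : (BettiUniverse.hodge exists_isReal_hodgeModel_holds hS 1).mtRank = 4 := by
    rcases mtRank_hodge_one_of_isSimple_surface_sharp hS hSs hS2 with ⟨h1, -⟩ | ⟨h2, -⟩ | ⟨-, -, hcm', -⟩ | ⟨-, -, h⟩
    · omega
    · omega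
    · exact absurd hcm' hScm
    · exact h
  obtain ⟨hsq, -, -⟩ := finrank_endAlgebra_eq_dim_sq_of_not_isOfCMType hS hS0 hScm h4S.le
  have hZ := center_endAlgebra_eq_bot_of_not_isOfCMType hS hS0 hScm h4S.le
  haveI : Nontrivial S.endAlgebra :=
    Literature.AlgebraicGeometry.ComplexMultiplication.nontrivial_endAlgebra_of_dim_pos hS0
  have hzS : Module.finrank ℚ (Subalgebra.center ℚ S.endAlgebra) = 1 := by rw [hZ, Subalgebra.finrank_bot]
  have hES : ¬ IsIsogenous E S := fun h => by
    obtain ⟨f, hf⟩ := h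
    have := dim_eq_of_isIsogeny hf
    omega
  exact (mtRank_hodge_one_eq_seven_of_isIsogenous_powSucc_prod_powSucc hX (isSimple_of_dim_le_one hE1.le) hSs (by omega)
    (by omega) (by omega) (by omega) hcm hScm (by rw [hfE, hE1]; rfl) hzE hsq hzS hES (a := 0) (b := 0) hXP).1

end Summit.HodgeConjecture.CorCM

end
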